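import Summits.AtomisticToContinuum.Crystallization.Theorems.ChartedZeroExcessLayeredLatticeLiouvilleZZZG
import Summits.AtomisticToContinuum.Crystallization.Theorems.ChartedZeroExcessLayeredLatticeLiouvilleZZZH
import Summits.AtomisticToContinuum.Crystallization.Theorems.ChartedZeroExcessLayeredLatticeLiouvilleZZZJ

/-!
# (B′.7e) ZZZK — ★★★ (CC) PROVED: the placed crystal has an onto global Barlow bond chart; hence (GL₂) AT THE RECORD DIALS UNCONDITIONALLY (9 theorems, 0 def)

Lineage `stmt-AtomisticToContinuum-26636` (route ChartedPlanarOrder), lens-2 g82 «structural dichotomy (special vs generic)».  The SPECIAL-class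
piece (CC) = `PlacedCrystalChartP (17/20) (10⁻⁴) 5` of ZZZG — LEMMA C's chart data, critic row 1519's first open item — is PROVED:

1. every site `x'` of the model crystal `H₀ = LayeredHom L' w'` of a cool shadow crystal is `(1/15, 8999/10000, 1)`-good, by the SHADOW TRANSFER
   ZZZH `isTwoShellGoodSet_of_envClose_record` of the `(1/16, 9/10, 1)`-goodness of its `(10⁻⁴, 5)`-envelope partner `x ∈ H` (`H` clean);
2. rooted at its base site `w' 0` (translation, tree TH `isTwoShellGoodSet_translate` / `isCharted_μS_translate`) and with the window widened to
   `aHi = 103/100` (`mono_window`), `H₀` is Barlow-charted by the PORTED gluing theorem ZZZJ `ShadowGluing.isCharted_μS`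
   (dials `(1/15, 8999/10000, 103/100)`; `(17/20)`-separation ⟹ uniformly discrete);
3. tree ZJ `exists_globalChart_of_isCharted` gives an ONTO global bond chart of `H₀`, and the placing isometry `v ↦ U⁻¹ v + t` carries it to
   `C = placedCrystal L' w' U t` (bonds are metric, `dist` is preserved).

Consequences (★★★): `bondLabelP₂_record` — **(GL₂) `BondLabelP₂ ϑc (1/10) 8 (145/16) 4 12 16 (17/20) (10⁻⁴) 5 (10⁻⁴) 10 (43/2) 1 2 (1/16) (1/50)`
holds for EVERY `ϑc`** (ZZZG's junction `bondLabelP₂_of_placedCrystalChartP`); hence (SV₂) ⟸ (GC₂) alone and the docket slot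
`coolMoatSlavedFillingP_tubeSlot_of_bondCoherence₂` with SEVEN hypotheses ((SC), (GC₂), (AR₂), (LN₂), (CV₂), (X1), (X2ᴸ♮)) — (GL₂) is discharged.

No new definition; 0 sorry; no instance, no notation. Credit: lens-3 `ChartedPlanarOrderBarlowGluing{Frame,Charts,}` (the gluing engine, ported in
ZZZI/ZZZJ), tree TH/ZJ/YZA (translation, onto chart, placing isometry); [HalesDSP2012, §1.3]; [ConwaySloane1999, Ch. 4 §6.3].
-/

noncomputable section

open scoped RealInnerProductSpace
open Set Metric
open Literature.Geometry.DiscreteGeometry (IsTwoShellGoodSet)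
open Literature.MathematicalPhysics.StatisticalMechanics (UniformlyDiscrete)

namespace Summit.AtomisticToContinuum.Crystallization.Theorems.ChartedZeroExcessLayeredLatticeLiouville

open Summit.AtomisticToContinuum.Crystallization.Theorems.ChartedPlanarOrderRigidityDoor (E3 IsClean IsCharted)
open Summit.AtomisticToContinuum.Crystallization.Theorems.ChartedPlanarOrderDensityDichotomy (μS IsSep)
open Summit.AtomisticToContinuum.Crystallization.Theorems.ChartedPlanarOrderCleanScaleP (IsCleanP isCleanP_μS_iff)
open Summit.AtomisticToContinuum.Crystallization.Theorems.ChartedPlanarOrderMesoCut (LayeredHom EnvClose)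

/-! ### ZZZK-1  Small kinematics: base site, translated separation -/

/-- the base site `w' 0` of a layered crystal (`m = i = j = 0`). [formal bookkeeping] -/
theorem base_mem_layeredHom (L' : E3 →L[ℝ] E3) (w' : ℤ → E3) : w' 0 ∈ LayeredHom L' w' :=
  ⟨0, 0, 0, by simp⟩

/-- separation is invariant under a common translation. [folklore] -/
theorem isSep_translate {σ : ℝ} {Y : Set E3} (v : E3) (h : IsSep σ Y) : IsSep σ ((fun p => p + v) '' Y) := by
  rintro _ ⟨x, hx, rfl⟩ _ ⟨y, hy, rfl⟩ hne
  rw [dist_add_right]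
  exact h x hx y hy fun e => hne (by rw [e])

/-- a `σ`-separated set (`σ > 0`) is uniformly discrete. [formal bookkeeping] -/
theorem uniformlyDiscrete_of_isSep {σ : ℝ} {Y : Set E3} (hσ : 0 < σ) (h : IsSep σ Y) : UniformlyDiscrete Y :=
  ⟨σ, hσ, h⟩

/-! ### ZZZK-2  The model crystal of a cool shadow crystal is good everywhere, hence charted ONTO -/

/-- ★ **shadow goodness**: every site of the model crystal `H₀ = LayeredHom L' w'` — `(17/20)`-separated and two-sided `(10⁻⁴, 5)`-shadowed by a
CLEAN `H` — is `(1/15, 8999/10000, 1)`-good in `H₀` (ZZZH's transfer at the record dials, site by site). [this file, g82] -/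
theorem layeredHom_good_of_shadow {H : Set E3} (hH : IsClean (μS H)) {L' : E3 →L[ℝ] E3} {w' : ℤ → E3}
    (hsep : IsSep (17 / 20) (LayeredHom L' w'))
    (hsh : ∀ x' ∈ LayeredHom L' w', ∃ x ∈ H, EnvClose (1 / 10000) 5 (LayeredHom L' w') x' H x) :
    ∀ x' ∈ LayeredHom L' w', IsTwoShellGoodSet (1 / 15) (8999 / 10000) 1 (LayeredHom L' w') x' := fun x' hx' => by
  obtain ⟨x, hx, hE⟩ := hsh x' hx'
  exact isTwoShellGoodSet_of_envClose_record ((isCleanP_μS_iff (aHi := 1) H).1 hH x hx) hsep hx' hE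

/-- ★★ **a `(17/20)`-separated set that is `(1/15, 8999/10000, 1)`-good at every site has an ONTO global Barlow bond chart** — root it at any site
(translation), widen the window to `103/100`, glue (ZZZJ `ShadowGluing.isCharted_μS`), un-translate (TH `isCharted_μS_translate`), and read off
the onto chart (ZJ `exists_globalChart_of_isCharted`). [this file, g82] -/
theorem exists_ontoChart_of_good {Y : Set E3} (hsep : IsSep (17 / 20) Y)
    (hgood : ∀ y ∈ Y, IsTwoShellGoodSet (1 / 15) (8999 / 10000) 1 Y y) {y₀ : E3} (hy₀ : y₀ ∈ Y) :
    ∃ (Ψ : ℤ × ℤ × ℤ → E3) (τ : ℤ → Bool), IsBarlowBondChart Y Set.univ Ψ τ ∧ ∀ p ∈ Y, ∃ x, Ψ x = p := by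
  have h0 : (0 : E3) ∈ (fun p => p + -y₀) '' Y := ⟨y₀, hy₀, add_neg_cancel y₀⟩
  have hgood₀ : ∀ q ∈ (fun p => p + -y₀) '' Y, IsTwoShellGoodSet (1 / 15) (8999 / 10000) (103 / 100) ((fun p => p + -y₀) '' Y) q := by
    rintro q ⟨q₀, hq₀, rfl⟩
    exact (isTwoShellGoodSet_translate (-y₀) (hgood q₀ hq₀)).mono_window le_rfl (by norm_num)
  have hud : UniformlyDiscrete ((fun p => p + -y₀) '' Y) := uniformlyDiscrete_of_isSep (by norm_num) (isSep_translate (-y₀) hsep)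
  have hch : IsCharted (μS ((fun p => p + -y₀) '' Y)) := ShadowGluing.isCharted_μS h0 hud hgood₀
  have hch' : IsCharted (μS Y) := by
    simpa only [Set.image_image, neg_add_cancel_right, Set.image_id'] using isCharted_μS_translate y₀ hch
  exact exists_globalChart_of_isCharted hch'

/-! ### ZZZK-3  ★★★ (CC) proved, and (GL₂) at the record dials -/

/-- ★★★ **(CC) PROVED — `PlacedCrystalChartP (17/20) (10⁻⁴) 5`**: the placed crystal `C = placedCrystal L' w' U t` of every cool shadow crystal of a
clean `H` carries an ONTO global Barlow bond chart (the chart of `H₀` pushed through the placing isometry `v ↦ U⁻¹ v + t`). [this file, g82] -/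
theorem placedCrystalChartP_record : PlacedCrystalChartP (17 / 20) (1 / 10000) 5 := by
  intro H hH L' w' U t hsep hsh
  obtain ⟨Ψ, τ, hΨ, hsurj⟩ := exists_ontoChart_of_good hsep (layeredHom_good_of_shadow hH hsep hsh) (base_mem_layeredHom L' w')
  have hd : ∀ y y', dist (U.symm (Ψ y) + t) (U.symm (Ψ y') + t) = dist (Ψ y) (Ψ y') := fun y y' => by
    rw [dist_add_right, U.symm.dist_map]
  refine ⟨fun y => U.symm (Ψ y) + t, τ, ⟨?_, ?_, ?_⟩, ?_⟩
  · intro y _ y' _ h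
    have h' : U.symm (Ψ y) + t = U.symm (Ψ y') + t := h
    exact hΨ.1 (Set.mem_univ y) (Set.mem_univ y') (U.symm.injective (add_right_cancel h'))
  · intro y _
    show U (U.symm (Ψ y) + t - t) ∈ LayeredHom L' w'
    simpa using hΨ.2.1 (Set.mem_univ y)
  · intro y _ y' _
    have e : IsBond (U.symm (Ψ y) + t) (U.symm (Ψ y') + t) ↔ IsBond (Ψ y) (Ψ y') := by simp only [IsBond, hd]
    exact e.trans (hΨ.2.2 y (Set.mem_univ y) y' (Set.mem_univ y'))
  · intro c hc
    obtain ⟨x, hx⟩ := hsurj (U (c - t)) hc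
    exact ⟨x, by simp [hx]⟩

/-- ★★★ **(GL₂) AT THE RECORD DIALS, UNCONDITIONALLY, for every `ϑc`** — ZZZG's junction fed with (CC). [this file, g82] -/
theorem bondLabelP₂_record (ϑc : ℝ) :
    BondLabelP₂ ϑc (1 / 10) 8 (145 / 16) 4 12 16 (17 / 20) (1 / 10000) 5 (1 / 10000) 10 (43 / 2) 1 2 (1 / 16) (1 / 50) :=
  bondLabelP₂_of_placedCrystalChartP placedCrystalChartP_record ϑc

/-- **(SV₂) ⟸ (GC₂) alone** at the record dials (ZZZE `singleVariantP₂_of_bondLabel₂` with (GL₂) discharged). [this file, g82] -/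
theorem singleVariantP₂_record_of_bondCoherence₂ {ϑc τ : ℝ}
    (hGC : BondCoherenceP₂ ϑc (1 / 10) 8 (145 / 16) 4 12 16 (17 / 20) (1 / 10000) 5 (1 / 10000) 10 (43 / 2) τ 1 2 (1 / 16) (1 / 50)) :
    SingleVariantP₂ ϑc (1 / 10) 8 (145 / 16) 4 12 16 (17 / 20) (1 / 10000) 5 (1 / 10000) 10 (43 / 2) τ 1 2 (1 / 16) (1 / 50) :=
  singleVariantP₂_of_bondLabel₂ (bondLabelP₂_record ϑc) hGC

/-- **THE DOCKET SLOT WITH (GL₂) DISCHARGED** — SEVEN hypotheses: (SC) ∧ (GC₂) ∧ (AR₂) ∧ (LN₂) ∧ (CV₂) ∧ (X1) ∧ (X2ᴸ♮) ⟹ the leaf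
`CoolMoatSlavedFillingP ϑc (1/100) (1/10) 8 4 12 16 16 (1/2) 1 2 (1/16) (1/50)` (ZZZE `coolMoatSlavedFillingP_tubeSlot_of_bondLabel₂` with
`hGL := bondLabelP₂_record ϑc`). [this file, g82] -/
theorem coolMoatSlavedFillingP_tubeSlot_of_bondCoherence₂ {ϑc lam : ℝ} (hlam : 0 < lam)
    (hSC : CoolZoneShadowCrystalP ϑc (1 / 10) 8 4 12 16 (17 / 20) (1 / 10000) 5 (1 / 10000) 10 (43 / 2) 1 2 (1 / 16) (1 / 50))
    (hGC : BondCoherenceP₂ ϑc (1 / 10) 8 (145 / 16) 4 12 16 (17 / 20) (1 / 10000) 5 (1 / 10000) 10 (43 / 2) (1 / 3000) 1 2 (1 / 16) (1 / 50))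
    (hAR : AnchorRegistrationP₂ ϑc (1 / 10) 8 (145 / 16) 4 12 16 (17 / 20) (1 / 10000) 5 (1 / 10000) 10 (43 / 2) (1 / 3000) (1 / 1000) 1 2
      (1 / 16) (1 / 50))
    (hLN : LabelledNetP₂ ϑc (1 / 10) 8 (145 / 16) 4 12 16 (17 / 20) (1 / 10000) 5 (1 / 10000) 10 (43 / 2) (1 / 3000) (1 / 100) (4 / 5) (1 / 2)
      2 1 2 (1 / 16) (1 / 50))
    (hCV : LabelCoveringP₂ ϑc (1 / 10) 8 (145 / 16) 4 12 16 (17 / 20) (1 / 10000) 5 (1 / 10000) 10 (43 / 2) (1 / 3000) 1 2 (1 / 16) (1 / 50))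
    (hX1 : TubeConvexityP ϑc (1 / 100) (1 / 10) 8 4 12 16 16 (1 / 2) (1 / 5000) 5 (3 / 400) (3 / 400) (1 / 10) lam 1 2 (1 / 16) (1 / 50))
    (hX2 : ShadowLoadedTubeAprioriP ϑc (1 / 100) (1 / 10) 8 4 12 16 16 (1 / 2) (1 / 5000) 5 (3 / 400) (3 / 400) (1 / 10) (17 / 20) (1 / 10000)
      (1 / 10000) (19 / 4) (21 / 4) (1 / 200) (1 / 200) (1 / 20) 1 2 (1 / 16) (1 / 50)) :
    CoolMoatSlavedFillingP ϑc (1 / 100) (1 / 10) 8 4 12 16 16 (1 / 2) 1 2 (1 / 16) (1 / 50) :=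
  coolMoatSlavedFillingP_tubeSlot_of_bondLabel₂ hlam hSC (bondLabelP₂_record ϑc) hGC hAR hLN hCV hX1 hX2

end Summit.AtomisticToContinuum.Crystallization.Theorems.ChartedZeroExcessLayeredLatticeLiouville

end
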